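import Summits.AtomisticToContinuum.BoseEinsteinCondensation.Theorems.BECThomsonPrincipleDensityResponseCompositionAt
import Summits.AtomisticToContinuum.BoseEinsteinCondensation.Theorems.BECInsertionCorrectorStaticResponseBoundMaxFormBoundHolds
import Summits.AtomisticToContinuum.BoseEinsteinCondensation.Theorems.BECInsertionCorrectorStaticResponseBoundTruncationCompactness
import HarnessLib

/-!
# Line `force-balance-constitutive` (crux `DensityResponse`, stmt-AtomisticToContinuum-9481): stub S4'' `TruncationLimitExotic` closed

Helper file (supports, does not close, the crux item) of lead c1.  The registered stub
`stub_truncationLimitExotic : TruncationLimitExotic` of the skeleton `Cruxes/DensityResponse/Lines/force_balance_constitutive.lean`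
(reshape 3) — the fixed-volume truncation limit `E₀(min(v,n),N,L) ↑ E₀(v,N,L)` for the EXOTIC admissible profiles (neither
integrable nor a solid hard core with integrable tail) — is a corollary of two theorems landed meanwhile by the sibling crux team
(`StaticResponseBound`, stmt-12057): the Literature form-core theorem `maxFormBound_of_isRepulsiveFiniteRange`
(`Literature/MathematicalPhysics/QuantumManyBody/PeriodicMaxFormBoundHardCore.lean`: the Bose `C¹` core realises the infimum of the
maximal form for EVERY repulsive finite-range `v`, hard sets of any shape included, via hard-layer decay), restated as
`FewBody.stub_maxFormBound`, and the reduction `UvThomsonForceWave.truncationLimit_of_maxFormBound`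
(`…StaticResponseBoundTruncationCompactness.lean`).  In fact the truncation limit holds for every admissible `v` at every `(N, L)`
(`truncationLimitAt_zero`), so the integrability / solid-hard-core case split of `…CompositionAt.lean` is no longer needed, and the
line is closed modulo its single remaining stub S2 `stub_constitutiveCore` (`densityResponse_of_constitutiveCore`).

References: B. Simon, J. Operator Theory 1 (1979) 37–47, Thm. 2.1; [ReedSimonIV1978] Thm. XIII.64 (monotone convergence of forms).
-/

noncomputable section

namespace Summit.AtomisticToContinuum.BoseEinsteinCondensation.Cruxes.DensityResponse.ForceBalanceConstitutive

open scoped ENNReal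
open Literature.MathematicalPhysics.QuantumManyBody.BoseGas
open Summit.AtomisticToContinuum.BoseEinsteinCondensation.Theses
open Summit.AtomisticToContinuum.BoseEinsteinCondensation.Cruxes.StaticResponseBound

/-- **The truncation limit at every admissible potential and every box**: for every repulsive finite-range `v`
(hard cores and exotic hard sets included), `TruncationLimitAt v 0`, i.e. for all `N`, `L > 0` with `E₀(v,N,L) < ∞` and
`ε > 0`, eventually in the truncation height `n`: `E₀(v,N,L) ≤ E₀(min(v,n),N,L) + ε`.  Simon's monotone form convergence
fed with the Literature form-core theorem for hard cores. [cite: ReedSimonIV1978, Thm. XIII.64] -/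
theorem truncationLimitAt_zero {v : ℝ → ℝ≥0∞} (hv : IsRepulsiveFiniteRange v) : TruncationLimitAt v 0 :=
  fun N L hL _ hE ε hε =>
    UvThomsonForceWave.truncationLimit_of_maxFormBound FewBody.stub_maxFormBound v hv N L hL hE ε hε

/-- **Registered stub S4'' `stub_truncationLimitExotic`, closed**: the truncation limit for exotic admissible profiles
(a special case of `truncationLimitAt_zero`). [cite: ReedSimonIV1978, Thm. XIII.64] -/
theorem stub_truncationLimitExotic : TruncationLimitExotic :=
  fun _v hv _ _ => truncationLimitAt_zero hv

/-- **The line modulo S2 alone**: the constitutive core (registered stub S2 `stub_constitutiveCore`) implies the crux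
`BECThomsonPrinciple.DensityResponse` BY NAME, for every admissible potential — the composition `stub_reduction3` with S4''
discharged. [folklore] -/
theorem densityResponse_of_constitutiveCore : ConstitutiveCore → BECThomsonPrinciple.DensityResponse :=
  fun h₂ => stub_reduction3 h₂ stub_truncationLimitExotic

end Summit.AtomisticToContinuum.BoseEinsteinCondensation.Cruxes.DensityResponse.ForceBalanceConstitutive

end
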